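import Mathlib
import HarnessLib
import Literature.Analysis.PDE.DivFormStrongMaximumPrinciple
import Summits.NavierStokesRegularity.NavierStokesRegularity.Theorems.PoloidalWindowDoorPoloidalWindowRigidityDivFormMoserStep

/-!
# Route `PoloidalWindowDoor`, crux K2 (stmt-NavierStokesRegularity-19708) — GLOBALISATION of a local weak solution of
# `div(a∇v) = 0` (towards `divFormStrongMaximumPrinciple_holds`, Gilbarg–Trudinger Thm 8.19)

The named fact `Literature.Analysis.PDE.divFormStrongMaximumPrinciple` (GT Thm 8.19) and the line stub it serves have
their data only on an open set `Ω`: coefficients `a` symmetric / `λ`-elliptic / `Λ`-bounded for `y ∈ Ω`, a solution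
`v ∈ C¹(Ω)` (`ContDiffOn`), and the weak equation `∫ Σᵢⱼ aᵢⱼ ∂ᵢv ∂ⱼη = 0` for tests with `tsupport η ⊆ Ω`.  The local
De Giorgi–Nash–Moser files of this chain (`…DivFormLocalCaccioppoli` and its sequels, seat ns-in-ser-b) are written —
like their entire-solution siblings `…DivFormCaccioppoli…` — for a GLOBALLY `C¹` function `w ≥ 1` and GLOBAL coefficient
hypotheses, with the equation against tests supported in an open set `U`.  This file is the one-time cutoff
modification that puts local data in that form (`globalise_local_solution`; the coefficient part alone is
`exists_global_coeff`, and `integrand_congr_coeff` says the weak-form integrand only sees the coefficients on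
`tsupport η`): given `closedBall x₁ ρ ⊆ Ω` (`ρ > 0`) and `v ≥ 1` on `Ω`,

* `aG := a` on `Ω`, `aG := λ·1` off `Ω` — measurable entries, symmetric, `λ`-elliptic and `|aGᵢⱼ| ≤ max Λ λ` EVERYWHERE;
* `w := 1 + χ (v - 1)` with a `C¹` cutoff `χ`, `0 ≤ χ ≤ 1`, `χ = 1` on `closedBall x₁ ρ`, `tsupport χ ⊆ Ω` (the margin
  `closedBall x₁ (ρ + δ) ⊆ Ω` exists because a compact set inside an open set has a closed thickening inside it) —
  `w ∈ C¹(ℝⁿ)`, `w ≥ 1`, `w = v` on `closedBall x₁ ρ`;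
* the weak equation for `(aG, w)` against EVERY `C¹_c` test with `tsupport η ⊆ ball x₁ ρ` (there `aG = a`,
  `Dw = Dv` on the open ball, and `Dη = 0` off `tsupport η`).

Seat ns-in-ser-a g7 (cell pub/ns-inputs), width piece W2 of ns-in-ser-b g5's programme for
`divFormStrongMaximumPrinciple_holds` (interfaces fixed on pub/ns-inputs/STATUS 2026-08-28T18:22:32Z); the cutoff is
`exists_closedBall_cutoff` of `…DivFormMoserStep`.

WHAT THIS IS NOT: no estimate, no Harnack inequality, no maximum principle; nothing here is specific to Navier–Stokes
and no NS statement is touched.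
-/

noncomputable section

open MeasureTheory Set Function Filter Topology Metric
open scoped Matrix

-- the summit and its single sub-problem share the name (CONVENTIONS §1), as in every Theorems file
set_option linter.dupNamespace false

namespace Summit.NavierStokesRegularity.NavierStokesRegularity.Theorems.PoloidalWindowDoorPoloidalWindowRigidityDivFormStrongMaximumPrincipleGlobalise

open Summit.NavierStokesRegularity.NavierStokesRegularity.Theorems.PoloidalWindowDoorPoloidalWindowRigidityDivFormMoserStep

variable {n : ℕ}

/-- **Globalisation of the coefficients.**  If `a` has measurable entries and is symmetric, `λ`-elliptic (`λ > 0`)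
and `Λ`-bounded on a measurable set `Ω`, then `aG := a` on `Ω`, `aG := λ·1` off `Ω` has measurable entries and is
symmetric, `λ`-elliptic and `(max Λ λ)`-bounded EVERYWHERE, and agrees with `a` on `Ω`. -/
theorem exists_global_coeff {Ω : Set (EuclideanSpace ℝ (Fin n))} (hΩ : MeasurableSet Ω)
    {a : EuclideanSpace ℝ (Fin n) → Matrix (Fin n) (Fin n) ℝ} {lam Λ : ℝ} (hlam : 0 < lam)
    (hmeas : ∀ i j, Measurable fun y => a y i j) (hsymm : ∀ y ∈ Ω, (a y).IsSymm)
    (hell : ∀ y ∈ Ω, ∀ ξ : Fin n → ℝ, lam * (ξ ⬝ᵥ ξ) ≤ ξ ⬝ᵥ (a y *ᵥ ξ))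
    (hbd : ∀ y ∈ Ω, ∀ i j, |a y i j| ≤ Λ) :
    ∃ aG : EuclideanSpace ℝ (Fin n) → Matrix (Fin n) (Fin n) ℝ,
      (∀ i j, Measurable fun y => aG y i j) ∧ (∀ y, (aG y).IsSymm) ∧
      (∀ y (ξ : Fin n → ℝ), lam * (ξ ⬝ᵥ ξ) ≤ ξ ⬝ᵥ (aG y *ᵥ ξ)) ∧
      (∀ y i j, |aG y i j| ≤ max Λ lam) ∧ (∀ y ∈ Ω, aG y = a y) := by
  classical
  obtain ⟨aG, haG⟩ : ∃ aG : EuclideanSpace ℝ (Fin n) → Matrix (Fin n) (Fin n) ℝ,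
      ∀ y, aG y = if y ∈ Ω then a y else lam • (1 : Matrix (Fin n) (Fin n) ℝ) := ⟨_, fun _ => rfl⟩
  have haGΩ : ∀ y ∈ Ω, aG y = a y := fun y hy => by rw [haG, if_pos hy]
  have haGc : ∀ y, y ∉ Ω → aG y = lam • (1 : Matrix (Fin n) (Fin n) ℝ) := fun y hy => by
    rw [haG, if_neg hy]
  refine ⟨aG, ?_, ?_, ?_, ?_, haGΩ⟩
  · -- measurable entries
    intro i j
    have h : (fun y => aG y i j) =
        fun y => if y ∈ Ω then a y i j else (lam • (1 : Matrix (Fin n) (Fin n) ℝ)) i j := by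
      funext y; rw [haG]; split_ifs <;> rfl
    rw [h]
    exact Measurable.ite hΩ (hmeas i j) measurable_const
  · -- symmetric
    intro y
    by_cases hy : y ∈ Ω
    · rw [haGΩ y hy]; exact hsymm y hy
    · rw [haGc y hy]; exact Matrix.isSymm_one.smul lam
  · -- elliptic
    intro y ξ
    by_cases hy : y ∈ Ω
    · rw [haGΩ y hy]; exact hell y hy ξ
    · rw [haGc y hy, Matrix.smul_mulVec, Matrix.one_mulVec, dotProduct_smul, smul_eq_mul]
  · -- bounded
    intro y i j
    by_cases hy : y ∈ Ω
    · rw [haGΩ y hy]; exact (hbd y hy i j).trans (le_max_left _ _)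
    · rw [haGc y hy, Matrix.smul_apply, Matrix.one_apply, smul_eq_mul]
      refine le_trans ?_ (le_max_right _ _)
      split_ifs <;> simp [abs_of_pos hlam, hlam.le]

/-- **The weak-form integrand only sees the coefficients on `tsupport η`.**  If `aG = a` on `Ω ⊇ tsupport η`, the
integrands `Σᵢⱼ aGᵢⱼ ∂ᵢv ∂ⱼη` and `Σᵢⱼ aᵢⱼ ∂ᵢv ∂ⱼη` coincide everywhere (off `tsupport η`, `Dη = 0`). -/
theorem integrand_congr_coeff {Ω : Set (EuclideanSpace ℝ (Fin n))}
    {a aG : EuclideanSpace ℝ (Fin n) → Matrix (Fin n) (Fin n) ℝ} (haG : ∀ y ∈ Ω, aG y = a y)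
    (v η : EuclideanSpace ℝ (Fin n) → ℝ) (hηΩ : tsupport η ⊆ Ω) :
    (fun y => ∑ i, ∑ j, aG y i j * fderiv ℝ v y (EuclideanSpace.single i 1) *
        fderiv ℝ η y (EuclideanSpace.single j 1)) =
      fun y => ∑ i, ∑ j, a y i j * fderiv ℝ v y (EuclideanSpace.single i 1) *
        fderiv ℝ η y (EuclideanSpace.single j 1) := by
  funext y
  by_cases hy : y ∈ Ω
  · rw [haG y hy]
  · have hη0 : fderiv ℝ η y = 0 := fderiv_of_notMem_tsupport ℝ (fun h => hy (hηΩ h))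
    simp [hη0]

/-- **Globalisation of a local weak solution by a cutoff.**  Let `Ω ⊆ ℝⁿ` be open, `a` a coefficient field with
measurable entries which is symmetric, `λ`-elliptic (`λ > 0`) and `Λ`-bounded ON `Ω`, `v ∈ C¹(Ω)` with `v ≥ 1` on `Ω`
a weak solution of `div(a∇v) = 0` in `Ω` (tests `η ∈ C¹_c` with `tsupport η ⊆ Ω`), and `closedBall x₁ ρ ⊆ Ω`,
`ρ > 0`.  Then there are `aG`, `w` defined on all of `ℝⁿ` with: `aG` measurable, symmetric, `λ`-elliptic,
`|aGᵢⱼ| ≤ max Λ λ` everywhere and `aG = a` on `Ω`; `w ∈ C¹(ℝⁿ)`, `w ≥ 1` everywhere, `w = v` on `closedBall x₁ ρ`;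
and `∫ Σᵢⱼ aGᵢⱼ ∂ᵢw ∂ⱼη = 0` for every `η ∈ C¹_c(ℝⁿ)` with `tsupport η ⊆ ball x₁ ρ`. -/
theorem globalise_local_solution {Ω : Set (EuclideanSpace ℝ (Fin n))} (hΩ : IsOpen Ω)
    {a : EuclideanSpace ℝ (Fin n) → Matrix (Fin n) (Fin n) ℝ} {lam Λ : ℝ} (hlam : 0 < lam)
    (hmeas : ∀ i j, Measurable fun y => a y i j) (hsymm : ∀ y ∈ Ω, (a y).IsSymm)
    (hell : ∀ y ∈ Ω, ∀ ξ : Fin n → ℝ, lam * (ξ ⬝ᵥ ξ) ≤ ξ ⬝ᵥ (a y *ᵥ ξ))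
    (hbd : ∀ y ∈ Ω, ∀ i j, |a y i j| ≤ Λ)
    {v : EuclideanSpace ℝ (Fin n) → ℝ} (hv : ContDiffOn ℝ 1 v Ω) (hv1 : ∀ y ∈ Ω, 1 ≤ v y)
    (hweak : ∀ η : EuclideanSpace ℝ (Fin n) → ℝ, ContDiff ℝ 1 η → HasCompactSupport η →
      tsupport η ⊆ Ω →
      ∫ y, ∑ i, ∑ j, a y i j * fderiv ℝ v y (EuclideanSpace.single i 1) *
        fderiv ℝ η y (EuclideanSpace.single j 1) = 0)
    {x₁ : EuclideanSpace ℝ (Fin n)} {ρ : ℝ} (hρ : 0 < ρ) (hB : closedBall x₁ ρ ⊆ Ω) :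
    ∃ (aG : EuclideanSpace ℝ (Fin n) → Matrix (Fin n) (Fin n) ℝ) (w : EuclideanSpace ℝ (Fin n) → ℝ),
      (∀ i j, Measurable fun y => aG y i j) ∧ (∀ y, (aG y).IsSymm) ∧
      (∀ y (ξ : Fin n → ℝ), lam * (ξ ⬝ᵥ ξ) ≤ ξ ⬝ᵥ (aG y *ᵥ ξ)) ∧
      (∀ y i j, |aG y i j| ≤ max Λ lam) ∧ (∀ y ∈ Ω, aG y = a y) ∧
      ContDiff ℝ 1 w ∧ (∀ y, 1 ≤ w y) ∧ (∀ y ∈ closedBall x₁ ρ, w y = v y) ∧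
      (∀ η : EuclideanSpace ℝ (Fin n) → ℝ, ContDiff ℝ 1 η → HasCompactSupport η →
        tsupport η ⊆ ball x₁ ρ →
        ∫ y, ∑ i, ∑ j, aG y i j * fderiv ℝ w y (EuclideanSpace.single i 1) *
          fderiv ℝ η y (EuclideanSpace.single j 1) = 0) := by
  -- a margin `closedBall x₁ (δ + ρ) ⊆ Ω`
  obtain ⟨δ, hδ, hδΩ⟩ := (isCompact_closedBall x₁ ρ).exists_cthickening_subset_open hΩ hB
  rw [cthickening_closedBall hδ.le hρ.le] at hδΩ
  -- the cutoff
  obtain ⟨C₀, -, hcut⟩ := exists_closedBall_cutoff n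
  obtain ⟨χ, hχ, -, hχ01, hχ1, hχ0, -⟩ := hcut x₁ ρ (δ + ρ) hρ (by linarith)
  have hsupp : support χ ⊆ ball x₁ (δ + ρ) := fun y hy => by
    by_contra h
    exact hy (hχ0 y h)
  have hχΩ : tsupport χ ⊆ Ω :=
    (closure_mono hsupp).trans (closure_ball_subset_closedBall.trans hδΩ)
  -- the extensions
  obtain ⟨aG, haGm, haGs, haGe, haGb, haGΩ⟩ := exists_global_coeff hΩ.measurableSet hlam hmeas hsymm hell hbd
  obtain ⟨w, hw⟩ : ∃ w : EuclideanSpace ℝ (Fin n) → ℝ, ∀ y, w y = 1 + χ y * (v y - 1) :=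
    ⟨_, fun _ => rfl⟩
  have hwfun : w = fun y => 1 + χ y * (v y - 1) := funext hw
  have hwB : ∀ y ∈ closedBall x₁ ρ, w y = v y := fun y hy => by
    rw [hw, hχ1 y hy]; ring
  refine ⟨aG, w, haGm, haGs, haGe, haGb, haGΩ, ?_, ?_, hwB, ?_⟩
  · -- `w ∈ C¹(ℝⁿ)`
    have hΩ' : ContDiffOn ℝ 1 w Ω := by
      rw [hwfun]
      exact contDiffOn_const.add (hχ.contDiffOn.mul (hv.sub contDiffOn_const))
    rw [contDiff_iff_contDiffAt]
    intro y
    by_cases hy : y ∈ Ω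
    · exact hΩ'.contDiffAt (hΩ.mem_nhds hy)
    · have hy' : y ∉ tsupport χ := fun h => hy (hχΩ h)
      have hev : χ =ᶠ[𝓝 y] 0 := notMem_tsupport_iff_eventuallyEq.1 hy'
      have hev' : w =ᶠ[𝓝 y] fun _ => (1 : ℝ) := hev.mono fun z hz => by
        rw [hw, hz, Pi.zero_apply, zero_mul, add_zero]
      exact contDiffAt_const.congr_of_eventuallyEq hev'
  · -- `w ≥ 1`
    intro y
    rw [hw]
    by_cases hy : y ∈ Ω
    · nlinarith [hv1 y hy, (hχ01 y).1]
    · have hy' : y ∉ tsupport χ := fun h => hy (hχΩ h)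
      rw [image_eq_zero_of_notMem_tsupport hy']; simp
  · -- the weak equation against tests supported in `ball x₁ ρ`
    intro η hη hηc hηU
    have hwv : ∀ y ∈ ball x₁ ρ, fderiv ℝ w y = fderiv ℝ v y := by
      intro y hy
      refine Filter.EventuallyEq.fderiv_eq ?_
      filter_upwards [isOpen_ball.mem_nhds hy] with z hz
      exact hwB z (ball_subset_closedBall hz)
    have hint : (fun y => ∑ i, ∑ j, aG y i j * fderiv ℝ w y (EuclideanSpace.single i 1) *
          fderiv ℝ η y (EuclideanSpace.single j 1)) =
        fun y => ∑ i, ∑ j, aG y i j * fderiv ℝ v y (EuclideanSpace.single i 1) *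
          fderiv ℝ η y (EuclideanSpace.single j 1) := by
      funext y
      by_cases hy : y ∈ ball x₁ ρ
      · rw [hwv y hy]
      · have hη0 : fderiv ℝ η y = 0 := fderiv_of_notMem_tsupport ℝ (fun h => hy (hηU h))
        simp [hη0]
    rw [hint, integrand_congr_coeff haGΩ v η (hηU.trans (ball_subset_closedBall.trans hB))]
    exact hweak η hη hηc (hηU.trans (ball_subset_closedBall.trans hB))

end Summit.NavierStokesRegularity.NavierStokesRegularity.Theorems.PoloidalWindowDoorPoloidalWindowRigidityDivFormStrongMaximumPrincipleGlobalise

end
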